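import Summits.Ventures.PercRepro.S1SpreadSlackZero
import Summits.Ventures.PercRepro.S1SpreadSlackZeroCover

/-!
# PercRepro — THE SLACK-ZERO STRUCTURE THEOREM WITHOUT THE PRIVATE-POINT CHOICE, AND `s₄ = 0` FOR PAIRWISE DISJOINT TRIANGLES
(p1, gen 36)

`proofs/P1-S2-CORANK6.md` §4u. **`fourCircuit_eq_sdiff_of_triangles_eq_nullity`**: on a spread e-free core of nullity `d ≥ 5` with
exactly `d` triangles every `4`-circuit is `(T₁ ∪ T₂) ∖ (T₁ ∩ T₂)` for two triangles sharing exactly one point (the structure lemma of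
the main module with the private-point choice discharged). **`ncard_fourCircuits_eq_zero_of_pairwise_disjoint`**: when the triangles
are pairwise disjoint there is no `4`-circuit at all — the row `t = d` of the spread case on a cell `(p, d)` with `p = 2d` (`n = 3d`,
e.g. `(12, 6)`), where the `d` triangles cover the `3d` points (`S1SpreadSlackZeroCover`) and are therefore pairwise disjoint.
Nothing about any cell is claimed. Axioms: standard.
-/

open scoped Matroid

namespace PercRepro

namespace S1

open Set

variable {α : Type}

/-- **Every `4`-circuit is the symmetric difference of two triangles sharing exactly one point** (`s₃ = d ≥ 5`). -/
theorem fourCircuit_eq_sdiff_of_triangles_eq_nullity (M : Matroid α) [M.Finite]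
    (hfree : ∀ e ∈ M.E, ∃ A ⊆ M.E \ {e}, e ∉ M.closure A ∧ e ∉ M.closure ((M.E \ {e}) \ A))
    (hns : ¬ ∃ W ⊆ M.E, W.ncard ≤ 9 ∧ W.encard = M.eRk W + 4) {d : ℕ} (hd : M.E.encard = M.eRank + d)
    (h5 : 5 ≤ d) (ht : {C : Set α | M.IsCircuit C ∧ C.ncard = 3}.ncard = d)
    {C : Set α} (hC : M.IsCircuit C) (hC4 : C.ncard = 4) :
    ∃ T₁ T₂ : Set α, M.IsCircuit T₁ ∧ T₁.ncard = 3 ∧ M.IsCircuit T₂ ∧ T₂.ncard = 3 ∧ T₁ ≠ T₂ ∧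
      (T₁ ∩ T₂).ncard = 1 ∧ C = (T₁ ∪ T₂) \ (T₁ ∩ T₂) := by
  classical
  have hC1 := lines_le_three_of_free M hfree
  have h9 := nullity_le_three_of_spread M hns
  have hno := no_six_of_five_le_triangles M hfree hns (by omega)
  set 𝒯s := {C : Set α | M.IsCircuit C ∧ C.ncard = 3} with h𝒯s
  have h𝒯fin : 𝒯s.Finite := M.ground_finite.finite_subsets.subset (fun C hC => hC.1.subset_ground)
  set 𝒯 := h𝒯fin.toFinset with h𝒯
  have h𝒯mem : ∀ T, T ∈ 𝒯 ↔ M.IsCircuit T ∧ T.ncard = 3 := fun T => Set.Finite.mem_toFinset h𝒯fin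
  have ht' : 𝒯.card = d := by rw [← Set.ncard_eq_toFinset_card 𝒯s h𝒯fin]; exact ht
  haveI : Nonempty α := by
    obtain ⟨T₀, hT₀⟩ : 𝒯s.Nonempty := Set.nonempty_of_ncard_ne_zero (by omega)
    obtain ⟨x, _⟩ : T₀.Nonempty := Set.nonempty_of_ncard_ne_zero (by rw [hT₀.2]; omega)
    exact ⟨x⟩
  have hpriv : ∀ T ∈ 𝒯, ∃ p ∈ T, ∀ T' ∈ 𝒯, T' ≠ T → p ∉ T' := by
    intro T hT
    obtain ⟨p, hp, hp'⟩ := exists_private_of_no_six M hfree hns hno ((h𝒯mem T).1 hT).1 ((h𝒯mem T).1 hT).2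
    exact ⟨p, hp, fun T' hT' hne => hp' T' ((h𝒯mem T').1 hT').1 ((h𝒯mem T').1 hT').2 hne⟩
  choose! priv hpT hpN using hpriv
  obtain ⟨T₁, T₂, hT₁, hT₂, h12, _, hI, hCeq⟩ :=
    fourCircuit_structure_of_priv M hC1 h9 hno hd 𝒯 (fun T hT => (h𝒯mem T).1 hT) ht' priv hpT hpN hC hC4
  exact ⟨T₁, T₂, ((h𝒯mem T₁).1 hT₁).1, ((h𝒯mem T₁).1 hT₁).2, ((h𝒯mem T₂).1 hT₂).1, ((h𝒯mem T₂).1 hT₂).2, h12, hI, hCeq⟩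

/-- **No `4`-circuit when the `d` triangles are pairwise disjoint** (`s₃ = d ≥ 5`). -/
theorem ncard_fourCircuits_eq_zero_of_pairwise_disjoint (M : Matroid α) [M.Finite]
    (hfree : ∀ e ∈ M.E, ∃ A ⊆ M.E \ {e}, e ∉ M.closure A ∧ e ∉ M.closure ((M.E \ {e}) \ A))
    (hns : ¬ ∃ W ⊆ M.E, W.ncard ≤ 9 ∧ W.encard = M.eRk W + 4) {d : ℕ} (hd : M.E.encard = M.eRank + d)
    (h5 : 5 ≤ d) (ht : {C : Set α | M.IsCircuit C ∧ C.ncard = 3}.ncard = d)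
    (hdisj : ∀ T T' : Set α, M.IsCircuit T → T.ncard = 3 → M.IsCircuit T' → T'.ncard = 3 → T ≠ T' → Disjoint T T') :
    {C : Set α | M.IsCircuit C ∧ C.ncard = 4}.ncard = 0 := by
  by_contra hne
  obtain ⟨C, hC, hC4⟩ := Set.nonempty_of_ncard_ne_zero hne
  obtain ⟨T₁, T₂, hT₁, hT₁3, hT₂, hT₂3, h12, hI, _⟩ :=
    fourCircuit_eq_sdiff_of_triangles_eq_nullity M hfree hns hd h5 ht hC hC4
  have h := hdisj T₁ T₂ hT₁ hT₁3 hT₂ hT₂3 h12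
  rw [Set.disjoint_iff_inter_eq_empty.1 h, Set.ncard_empty] at hI
  omega

/-- **On `3d` points the `d` triangles are pairwise disjoint** (coloop-free, `s₃ = d ≥ 5`): they cover the ground set. -/
theorem triangles_pairwise_disjoint_of_ncard_eq_three_mul (M : Matroid α) [M.Finite]
    (hfree : ∀ e ∈ M.E, ∃ A ⊆ M.E \ {e}, e ∉ M.closure A ∧ e ∉ M.closure ((M.E \ {e}) \ A))
    (hns : ¬ ∃ W ⊆ M.E, W.ncard ≤ 9 ∧ W.encard = M.eRk W + 4) {d : ℕ} (hd : M.E.encard = M.eRank + d)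
    (h5 : 5 ≤ d) (ht : {C : Set α | M.IsCircuit C ∧ C.ncard = 3}.ncard = d) (hK : ∀ e, ¬ M.IsColoop e)
    (hn : M.E.ncard = 3 * d) :
    ∀ T T' : Set α, M.IsCircuit T → T.ncard = 3 → M.IsCircuit T' → T'.ncard = 3 → T ≠ T' → Disjoint T T' := by
  classical
  intro T T' hT hT3 hT' hT'3 hne
  by_contra hmeet
  obtain ⟨x, hxT, hxT'⟩ := Set.not_disjoint_iff.1 hmeet
  have hcover := ground_subset_biUnion_of_triangles_eq_nullity M hfree hns hd h5 ht hK
  set 𝒯s := {C : Set α | M.IsCircuit C ∧ C.ncard = 3} with h𝒯s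
  have h𝒯fin : 𝒯s.Finite := M.ground_finite.finite_subsets.subset (fun C hC => hC.1.subset_ground)
  have hT𝒯 : T ∈ h𝒯fin.toFinset := (Finite.mem_toFinset h𝒯fin).2 ⟨hT, hT3⟩
  have hT'𝒯 : T' ∈ h𝒯fin.toFinset := (Finite.mem_toFinset h𝒯fin).2 ⟨hT', hT'3⟩
  have hcard : h𝒯fin.toFinset.card = d := by rw [← Set.ncard_eq_toFinset_card 𝒯s h𝒯fin]; exact ht
  -- `E ⊆ (T ∖ {x}) ∪ ⋃ (the other triangles)`: at most `2 + 3 (d − 1)` points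
  have hsub : M.E ⊆ (T \ {x}) ∪ ⋃ S ∈ h𝒯fin.toFinset.erase T, S := by
    intro e he
    have := hcover he
    simp only [mem_iUnion, exists_prop] at this
    obtain ⟨S, hS, heS⟩ := this
    by_cases hST : S = T
    · subst hST
      by_cases hex : e = x
      · subst hex
        refine Or.inr ?_
        simp only [mem_iUnion, exists_prop]
        exact ⟨T', Finset.mem_erase.2 ⟨Ne.symm hne, hT'𝒯⟩, hxT'⟩
      · exact Or.inl ⟨heS, hex⟩
    · refine Or.inr ?_
      simp only [mem_iUnion, exists_prop]
      exact ⟨S, Finset.mem_erase.2 ⟨hST, (Finite.mem_toFinset h𝒯fin).2 hS⟩, heS⟩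
  have hTfin : T.Finite := M.ground_finite.subset hT.subset_ground
  have hUfin : (⋃ S ∈ h𝒯fin.toFinset.erase T, S).Finite :=
    Set.Finite.biUnion (Finset.finite_toSet _) (fun S hS => M.ground_finite.subset
      ((Finite.mem_toFinset h𝒯fin).1 (Finset.mem_of_mem_erase hS)).1.subset_ground)
  have h1 := Set.ncard_le_ncard hsub ((hTfin.subset sdiff_subset).union hUfin)
  have h2 := Set.ncard_union_le (T \ {x}) (⋃ S ∈ h𝒯fin.toFinset.erase T, S)
  have h3 : (T \ {x}).ncard + 1 = 3 := by rw [Set.ncard_sdiff_singleton_add_one hxT hTfin, hT3]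
  have h4 : (⋃ S ∈ h𝒯fin.toFinset.erase T, S).ncard ≤ 3 * (d - 1) := by
    calc (⋃ S ∈ h𝒯fin.toFinset.erase T, S).ncard ≤ ∑ S ∈ h𝒯fin.toFinset.erase T, S.ncard :=
          Finset.set_ncard_biUnion_le _ _
      _ = ∑ S ∈ h𝒯fin.toFinset.erase T, 3 := Finset.sum_congr rfl (fun S hS =>
          ((Finite.mem_toFinset h𝒯fin).1 (Finset.mem_of_mem_erase hS)).2)
      _ = 3 * (d - 1) := by rw [Finset.sum_const, smul_eq_mul, Finset.card_erase_of_mem hT𝒯, hcard, mul_comm]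
  omega

/-- **The row `t = d` on `3d` points has no `4`-circuit** (coloop-free spread e-free core, `s₃ = d ≥ 5`, `|E| = 3d`). -/
theorem ncard_fourCircuits_eq_zero_of_ncard_eq_three_mul (M : Matroid α) [M.Finite]
    (hfree : ∀ e ∈ M.E, ∃ A ⊆ M.E \ {e}, e ∉ M.closure A ∧ e ∉ M.closure ((M.E \ {e}) \ A))
    (hns : ¬ ∃ W ⊆ M.E, W.ncard ≤ 9 ∧ W.encard = M.eRk W + 4) {d : ℕ} (hd : M.E.encard = M.eRank + d)
    (h5 : 5 ≤ d) (ht : {C : Set α | M.IsCircuit C ∧ C.ncard = 3}.ncard = d) (hK : ∀ e, ¬ M.IsColoop e)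
    (hn : M.E.ncard = 3 * d) : {C : Set α | M.IsCircuit C ∧ C.ncard = 4}.ncard = 0 :=
  ncard_fourCircuits_eq_zero_of_pairwise_disjoint M hfree hns hd h5 ht
    (triangles_pairwise_disjoint_of_ncard_eq_three_mul M hfree hns hd h5 ht hK hn)

end S1

end PercRepro
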